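import Literature.NumberTheory.Transcendental.AnalytificationProduct
import Literature.NumberTheory.Transcendental.AnalytificationMorphismsProofs
import Literature.AlgebraicGeometry.Motives.GrpObjOfAlgPoints
import Literature.AlgebraicGeometry.Motives.JacobianAlbanese
import Literature.AlgebraicGeometry.Motives.SegreEmbedding
import Literature.AlgebraicGeometry.Motives.VarietiesGeometricallyIntegralProofs
import Literature.AlgebraicGeometry.Motives.VarietiesDimensionProofs
import Literature.AlgebraicGeometry.Motives.VarietiesProperProofs
import Literature.Geometry.Kaehler.ComplexTorusLieGroup
import HarnessLib

/-!
# The algebraic group law of a projective complex torus: `X = V/Λ` is an abelian variety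

Topic `Literature/AlgebraicGeometry/Motives` (family `hodge`), namespace
`Literature.AlgebraicGeometry.Motives`. Theorems only; no definition, no named fact, no `sorry`.

Let `T = V/Λ` be a complex torus (the tree's `Literature.Geometry.Kaehler.ComplexTorus Φ`, `Φ : ℝ^ι ≃ E`
a period isomorphism, with its holomorphic atlas `IsManifold 𝓘(ℂ, E) ω`) which is *projective*, i.e.
which is the analytification of a smooth projective complex variety `Y`
(`Literature.NumberTheory.Transcendental.IsAnalytification E Y n ψ` for a map `ψ : T → Y(ℂ)` and
`Literature.AlgebraicGeometry.Motives.IsSmoothProjective n Y`; by Lefschetz's theorem this is the case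
as soon as `T` carries a Riemann form — tree `Geometry/Kaehler/SiegelTorusThetaEmbedding*.lean`,
`Summits/HodgeConjecture/CorCM/Geometry/PolarisedTorusAlgebraic.lean`). Then **the group law of `T` is
algebraic**: there are `ℂ`-morphisms `m : Y ×_ℂ Y → Y`, `i : Y → Y` and a rational point `e ∈ Y(ℂ)`
inducing `(x, y) ↦ x + y`, `x ↦ -x`, `0` on `T = Y(ℂ)`, and `(Y, m, e, i)` is an **abelian variety**
whose group of complex points is `T` (Mumford, *Algebraic Geometry I: Complex Projective Varieties*
(1981), §4B, Corollary (4.14) p. 67 and its application to complex tori; Lange–Birkenhake, *Complex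
Abelian Varieties* (1992), Ch. 2 §1, Thm. 2.1.13 / Cor. 2.1.17 with §1.1: "an abelian variety is a
complex torus admitting a positive definite line bundle … by Chow's theorem it is an algebraic
group"; Mumford, *Abelian Varieties* (1970), §1 (1)–(3)).

The proof is the printed one, run on the tree's kernel theorems:

* the addition `T × T → T` is holomorphic for the product complex structure
  (`ComplexTorus.contMDiff_add` of `Literature/Geometry/Kaehler/ComplexTorusLieGroup.lean`,
  Lange–Birkenhake §1.1.1) and `T × T` is the analytification of
  `Y ×_ℂ Y` (`IsAnalytification.prod`, Serre GAGA §2 n°5), so by **GAGA for maps**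
  (`arapura2012_cor_15_4_6_holds`: Arapura 2012 Cor. 15.4.6 = Mumford 1981 (4.14), "a holomorphic map
  between nonsingular projective varieties is a morphism") it is induced by a morphism
  `m : Y ×_ℂ Y → Y` (`exists_mulHom_of_complexTorus_isAnalytification`); likewise negation
  (`ComplexTorus.contMDiff_neg`) is induced by `i : Y → Y` (`exists_invHom_of_complexTorus_isAnalytification`);
* the group axioms for `(m, e, i)` hold on `ℂ`-points, where `ψ⁻¹ : Y(ℂ) ≃ T` carries them to the
  group axioms of `T`, hence as morphisms (`GrpObj.ofAlgPointsOfInjective`: `Y` is geometrically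
  integral, separated and of finite type — Silverman AEC III.3.6 pattern, Görtz–Wedhorn I 9.2);
* `Y → Spec ℂ` is proper (projective) and geometrically integral (smooth + geometrically
  irreducible), so `(Y, m, e, i)` is a `Motives.AbelianVariety ℂ`, of dimension `n`
  (`schemeDim_eq_holds`).

Main statements:

* `exists_grpObj_of_complexTorus_isAnalytification` — `Y` fixed: a group-scheme structure
  `G : GrpObj Y` whose multiplication, unit and inverse induce `+`, `0`, `-` of `T` through `ψ`,
  with `IsProper Y.hom` and `GeometricallyIntegral Y.hom`;
* `exists_abelianVariety_of_complexTorus_isAnalytification` — packaged: an abelian variety `A` over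
  `ℂ` with `A.X = Y`, `A.dim = n`, and an analytification `φ : T → A(ℂ)` (`φ = ψ`) which is a group
  isomorphism onto Mathlib's group `A(ℂ) = Hom_ℂ(Spec ℂ, A.X)` (`φ (x + y) = φ x * φ y`, `φ 0 = 1`,
  `φ (-x) = (φ x)⁻¹`) — the exact shape of the uniformisation record
  `HodgeTheory.complexAbelianVariety_torusUniformised` read from the torus side.

All types are in `Type` (universe `0`), as in the record `Arapura2012_Cor_15_4_6` that is applied.

Not here: the projectivity of polarised tori (Lefschetz; the files quoted above), the uniqueness of
the algebraic structure, the functoriality `Hom(T, T') → Hom(A, A')` (again GAGA for maps plus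
rigidity, `AbelianVariety.homOfOneComp`).

## References

* D. Mumford, *Algebraic Geometry I: Complex Projective Varieties*, Grundlehren 221 (1981), §4B,
  Corollary (4.14), p. 67. [Mumford1981]
* H. Lange, Ch. Birkenhake, *Complex Abelian Varieties*, Grundlehren 302 (1992), §1.1 and Ch. 2 §1
  (Thm. 2.1.13, Cor. 2.1.17; Chow's theorem). [LangeBirkenhake1992]
* D. Mumford, *Abelian Varieties* (1970), §1 (1)–(3). [MumfordAV1970]
* D. Arapura, *Algebraic Geometry over the Complex Numbers* (2012), Cor. 15.4.6. [Arapura2012]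
* J.-P. Serre, *Géométrie algébrique et géométrie analytique* (1956), §2 n°5. [SerreGAGA1956]
-/

noncomputable section

open scoped Manifold ContDiff Topology MonObj
open CategoryTheory AlgebraicGeometry MonoidalCategory CartesianMonoidalCategory
open Literature.NumberTheory.Transcendental Literature.Geometry.Kaehler

namespace Literature.AlgebraicGeometry.Motives

variable {ι : Type} [Fintype ι] {E : Type} [NormedAddCommGroup E] [NormedSpace ℂ E]
  [FiniteDimensional ℂ E] {Φ : (ι → ℝ) ≃L[ℝ] E} {n : ℕ} {Y : SchemeOver ℂ}
  {ψ : ComplexTorus Φ → ComplexPoints Y}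

/-! ### The group operations of a projective torus are algebraic (GAGA for maps) -/

/-- **The addition of a projective complex torus is algebraic.** If the complex torus `T = V/Λ`
(`ComplexTorus Φ`) is the analytification of the smooth projective variety `Y` through
`ψ : T → Y(ℂ)`, then there is a morphism `m : Y ×_ℂ Y → Y` over `ℂ` with `ψ (x + y) = m(ℂ)(ψ x, ψ y)`, i.e. `ψ (x + y) = ⟨ψ x, ψ y⟩ ≫ m` on
`ℂ`-points. GAGA for maps (Mumford 1981 (4.14); Arapura 2012 Cor. 15.4.6, the tree's
`arapura2012_cor_15_4_6_holds`) applied on the product analytification `T × T = (Y ×_ℂ Y)^an`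
(`IsAnalytification.prod`). [cite: Mumford1981, §4B Corollary (4.14), p. 67] -/
theorem exists_mulHom_of_complexTorus_isAnalytification (hY : IsSmoothProjective n Y)
    (hψ : IsAnalytification E Y n ψ) :
    ∃ m : Y ⊗ Y ⟶ Y, ∀ x y : ComplexTorus Φ, ψ (x + y) = lift (ψ x) (ψ y) ≫ m := by
  classical
  haveI : SmoothOfRelativeDimension n Y.hom := hY.smoothOfRelativeDimension
  haveI : Smooth Y.hom := SmoothOfRelativeDimension.smooth n Y.hom
  haveI : LocallyOfFiniteType Y.hom := inferInstance
  haveI : IsProper Y.hom := IsSmoothProjective.isProper_holds hY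
  haveI : IsSeparated Y.hom := inferInstance
  have hYY : IsSmoothProjective (n + n) (Y ⊗ Y) := IsSmoothProjective.tensor_holds hY hY
  -- the product complex manifold `T × T`, read with the self model `𝓘(ℂ, E × E)`
  letI : ChartedSpace (E × E) (ComplexTorus Φ × ComplexTorus Φ) :=
    prodChartedSpace E (ComplexTorus Φ) E (ComplexTorus Φ)
  haveI : IsManifold 𝓘(ℂ, E × E) ω (ComplexTorus Φ × ComplexTorus Φ) := by
    rw [modelWithCornersSelf_prod]
    exact inferInstanceAs (IsManifold (𝓘(ℂ, E).prod 𝓘(ℂ, E)) ω (ComplexTorus Φ × ComplexTorus Φ))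
  have hψψ := hψ.prod hψ
  -- the addition of `T` is holomorphic on the product manifold (`ComplexTorus.contMDiff_add`)
  have hadd : MDifferentiable (𝓘(ℂ, E).prod 𝓘(ℂ, E)) 𝓘(ℂ, E)
      (fun p : ComplexTorus Φ × ComplexTorus Φ ↦ p.1 + p.2) :=
    (ComplexTorus.contMDiff_add (Φ := Φ) (𝕜 := ℂ) (n := 1)).mdifferentiable one_ne_zero
  have hadd' : MDifferentiable 𝓘(ℂ, E × E) 𝓘(ℂ, E)
      (fun p : ComplexTorus Φ × ComplexTorus Φ ↦ p.1 + p.2) := by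
    rw [modelWithCornersSelf_prod]
    exact hadd
  obtain ⟨m, hm⟩ := arapura2012_cor_15_4_6_holds (Y ⊗ Y) Y hYY hY (E × E)
    (ComplexTorus Φ × ComplexTorus Φ) _ hψψ E (ComplexTorus Φ) ψ hψ _ hadd'
  refine ⟨m, fun x y ↦ ?_⟩
  have h := hm (x, y)
  simpa only [AlgPoints.map, AlgPoints.prodEquiv_symm_apply] using h

/-- **The negation of a projective complex torus is algebraic**: with `T = Y(ℂ)^an` as above there
is a morphism `i : Y → Y` over `ℂ` with `ψ (-x) = i(ℂ)(ψ x) = ψ x ≫ i`. GAGA for maps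
(`arapura2012_cor_15_4_6_holds`) applied to the holomorphic map `x ↦ -x`
(`ComplexTorus.contMDiff_neg`). [cite: Mumford1981, §4B Corollary (4.14), p. 67] -/
theorem exists_invHom_of_complexTorus_isAnalytification (hY : IsSmoothProjective n Y)
    (hψ : IsAnalytification E Y n ψ) :
    ∃ i : Y ⟶ Y, ∀ x : ComplexTorus Φ, ψ (-x) = ψ x ≫ i := by
  have hneg : MDifferentiable 𝓘(ℂ, E) 𝓘(ℂ, E) (fun x : ComplexTorus Φ ↦ -x) :=
    (ComplexTorus.contMDiff_neg (Φ := Φ) (𝕜 := ℂ) (n := 1)).mdifferentiable one_ne_zero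
  obtain ⟨i, hi⟩ := arapura2012_cor_15_4_6_holds Y Y hY hY E (ComplexTorus Φ) ψ hψ E
    (ComplexTorus Φ) ψ hψ _ hneg
  exact ⟨i, fun x ↦ hi x⟩

/-! ### The group-scheme structure and the abelian variety -/

/-- **A projective complex torus is a group scheme.** If `T = V/Λ` (`ComplexTorus Φ`) is the
analytification of the smooth projective `ℂ`-variety `Y` through `ψ : T → Y(ℂ)`, then `Y` carries a structure of `ℂ`-group scheme `(m, e, i)` (Mathlib `GrpObj` in
`Over (Spec ℂ)`) inducing on `ℂ`-points the group law of `T`: `⟨ψ x, ψ y⟩ ≫ m = ψ (x + y)`,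
`e = ψ 0`, `ψ x ≫ i = ψ (-x)`; moreover `Y → Spec ℂ` is proper and geometrically integral. The
operations are algebraic by GAGA for maps (`exists_mulHom_of_complexTorus_isAnalytification`,
`exists_invHom_of_complexTorus_isAnalytification`), and the axioms hold because they hold on
`ℂ`-points, `ψ⁻¹ : Y(ℂ) → T` being an injection into a group compatible with the three operations
(`GrpObj.ofAlgPointsOfInjective`). Mumford 1981, §4B (4.14) and the discussion of complex tori;
Lange–Birkenhake 1992, §1.1 and Thm. 2.1.13 / Cor. 2.1.17 ("by Chow's theorem it is an algebraic
group"). [cite: Mumford1981, §4B Corollary (4.14), p. 67]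
[cite: LangeBirkenhake1992, Ch. 2 §1 Thm. 2.1.13 and Cor. 2.1.17] -/
theorem exists_grpObj_of_complexTorus_isAnalytification (hY : IsSmoothProjective n Y)
    (hψ : IsAnalytification E Y n ψ) :
    ∃ G : GrpObj Y,
      (∀ x y : ComplexTorus Φ, lift (ψ x) (ψ y) ≫ G.mul = ψ (x + y)) ∧
      toUnit _ ≫ G.one = ψ 0 ∧
      (∀ x : ComplexTorus Φ, ψ x ≫ G.inv = ψ (-x)) ∧
      IsProper Y.hom ∧ GeometricallyIntegral Y.hom := by
  classical
  haveI : SmoothOfRelativeDimension n Y.hom := hY.smoothOfRelativeDimension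
  haveI : Smooth Y.hom := SmoothOfRelativeDimension.smooth n Y.hom
  haveI : LocallyOfFiniteType Y.hom := inferInstance
  haveI : IsProper Y.hom := IsSmoothProjective.isProper_holds hY
  haveI : IsSeparated Y.hom := inferInstance
  haveI : GeometricallyIntegral Y.hom := IsSmoothProjective.geometricallyIntegral_holds hY
  obtain ⟨m, hm⟩ := exists_mulHom_of_complexTorus_isAnalytification hY hψ
  obtain ⟨i, hi⟩ := exists_invHom_of_complexTorus_isAnalytification hY hψ
  -- `ψ⁻¹ : Y(ℂ) → T`, an injection into the group `T` compatible with `m`, `e = ψ 0`, `i`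
  let e : ComplexTorus Φ ≃ₜ ComplexPoints Y := hψ.homeomorph
  have hone : toUnit (specOver ℂ ℂ) ≫ (ψ 0).toUnitHom = ψ 0 := by
    rw [AlgPoints.toUnit_comp_toUnitHom, ← eq_toSpecOver (𝟙 _), Category.id_comp]
  have hm' : ∀ x y : ComplexTorus Φ, lift (e x) (e y) ≫ m = e (x + y) := fun x y ↦ (hm x y).symm
  have hi' : ∀ x : ComplexTorus Φ, e x ≫ i = e (-x) := fun x ↦ (hi x).symm
  have hmul' : ∀ P Q : AlgPoints Y ℂ, e.symm (lift P Q ≫ m) = e.symm P + e.symm Q := by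
    intro P Q
    obtain ⟨x, rfl⟩ := e.surjective P
    obtain ⟨y, rfl⟩ := e.surjective Q
    rw [hm', e.symm_apply_apply, e.symm_apply_apply, e.symm_apply_apply]
  have hone' : e.symm (toUnit _ ≫ (ψ 0).toUnitHom) = 0 := by
    rw [hone]
    exact e.symm_apply_apply 0
  have hinv' : ∀ P : AlgPoints Y ℂ, e.symm (P ≫ i) = -e.symm P := by
    intro P
    obtain ⟨x, rfl⟩ := e.surjective P
    rw [hi', e.symm_apply_apply, e.symm_apply_apply]
  refine ⟨GrpObj.ofAlgPointsOfInjective (Ω := ℂ) (mul := m) (one := (ψ 0).toUnitHom) (inv := i)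
      (G := ComplexTorus Φ) (fun P ↦ e.symm P) e.symm.injective hmul' hone' hinv',
    fun x y ↦ (hm x y).symm, hone, fun x ↦ (hi x).symm, inferInstance, inferInstance⟩

/-- **A projective complex torus is an abelian variety** (Mumford 1981, §4B (4.14) Corollary and
the ensuing discussion; Lange–Birkenhake 1992, Thm. 2.1.13 / Cor. 2.1.17 with §1.1; Mumford,
*Abelian Varieties*, §1 (1)–(3): "a compact complex-analytic manifold with an (analytic) group
structure … which can be embedded in projective space is an abelian variety"). If the complex torus
`T = V/Λ` (`ComplexTorus Φ`) is the analytification of the smooth projective `ℂ`-variety `Y` of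
dimension `n` through `ψ : T → Y(ℂ)`, then there is an abelian variety `A` over `ℂ` (`Motives.AbelianVariety ℂ`: proper, geometrically integral `ℂ`-group
scheme) with underlying scheme `A.X = Y`, `dim A = n`, together with an analytification
`φ : T → A(ℂ)` (namely `ψ`) which is an isomorphism of groups onto the group `A(ℂ)` of complex
points: `φ (x + y) = φ x · φ y`, `φ 0 = 1`, `φ (-x) = (φ x)⁻¹`.
[cite: Mumford1981, §4B Corollary (4.14), p. 67]
[cite: LangeBirkenhake1992, Ch. 2 §1 Thm. 2.1.13 and Cor. 2.1.17] [cite: MumfordAV1970, §1 (1)–(3)] -/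
theorem exists_abelianVariety_of_complexTorus_isAnalytification (hY : IsSmoothProjective n Y)
    (hψ : IsAnalytification E Y n ψ) :
    ∃ (A : AbelianVariety ℂ) (φ : ComplexTorus Φ → ComplexPoints A.X),
      A.X = Y ∧ A.dim = n ∧ IsAnalytification E A.X n φ ∧ IsSmoothProjective n A.X ∧
      (∀ x y : ComplexTorus Φ, φ (x + y) = φ x * φ y) ∧ φ 0 = 1 ∧
      ∀ x : ComplexTorus Φ, φ (-x) = (φ x)⁻¹ := by
  obtain ⟨G, hmul, hone, hinv, hproper, hgi⟩ :=
    exists_grpObj_of_complexTorus_isAnalytification hY hψ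
  let A : AbelianVariety ℂ :=
    { X := Y, grpObj := G, isProper := hproper, geometricallyIntegral := hgi }
  refine ⟨A, ψ, rfl, schemeDim_eq_holds hY, hψ, hY, fun x y ↦ ?_, ?_, fun x ↦ ?_⟩
  · rw [Hom.mul_def]
    exact (hmul x y).symm
  · rw [Hom.one_def]
    exact hone.symm
  · rw [Hom.inv_def]
    exact (hinv x).symm

end Literature.AlgebraicGeometry.Motives
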